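/-
Copyright (c) 2026 the pub-hodgecm-mathlib formalisation cell (harness21).  Prover seat hodgecm-mathlib-K2E1-p13 (g2), Track B ∕ K2-LIT, h413 = `stmt-HodgeConjecture-24833`,
line `K2_E1_TraceFormulaBeta`, ROADCARD «5Res ENDGAME BY FAMILIES» (dealer K2E1-plan (g7) (240)): the archimedean letter (K∞) — `GL_N((c ⊗ 1))` preserves `K_∞ = ∏_{w real} O(N) × ∏_{w complex} U(N)`.
-/
import Summits.HodgeConjecture.HodgeConjecture.Theorems.K2E1QuasiSplitGaloisTwistMaximalCompactU   -- ★ (K) p860364 (this seat): `map_conjAdele_mem_standardMaximalCompactGL` (mod `hKinf`), brings ★ `ReductionTheoryGLn`, `conjAdele`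
import Mathlib.Analysis.Complex.Basic
import HarnessLib

/-!
# `K2E1QuasiSplitGaloisTwistArchCompactU` — (K∞): `GL_N((c ⊗ 1))` PRESERVES THE ARCHIMEDEAN MAXIMAL COMPACT `K_∞`; HENCE `K_max = K_∞·GL_N(𝒪̂_E)` IS `c`-STABLE, LETTER-FREE

Track B ∕ K2-LIT, crux h413 = `stmt-HodgeConjecture-24833`, route of record `HCCMUnconditional`; cell `hodgecm-mathlib`, squad K2, ENGINE E1.  THEOREMS ONLY (no `def`, no `instance`,
no `notation`, no `sorry`; default heartbeats); lane `--supports stmt-HodgeConjecture-24833 --as helper` (count-neutral).  Generic `GL_N(𝔸_E)`, `c ∈ Aut(E∕F)`.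

THE MATHEMATICS ([BorelJacquet1979, §1.1]; [Knapp2002, I.§1]).  §1 (Mathlib-only rigidity): a ring homomorphism compatible with `star` maps unitary matrices to unitary matrices
(`(A.map ρ)ᴴ(A.map ρ) = (AᴴA).map ρ = 1`); EVERY ring endomorphism of `ℝ` (trivial star) and every CONTINUOUS ring endomorphism of `ℂ` (`= id` or `conj`, Mathlib
`Complex.ringHom_eq_id_or_conj_of_continuous`) is `star`-compatible.  §2: `(c ⊗ 1)` acts on `E_∞ = ∏_{w∣∞} E_w` by `(c x)_w = c_{w₀→w}(x_{w₀})`, `w₀ = c⁻¹w` of the SAME type (Mathlib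
`isReal_smul_iff`∕`isComplex_smul_iff`), through the continuous ring isomorphisms `c_{w₀→w} : E_{w₀} ≃ E_w` (★ `galInfiniteCompletionMap`); in the coordinates `E_w ≅ ℝ` resp. `ℂ` (Mathlib
`ringEquivRealOfIsReal`∕`ringEquivComplexOfIsComplex`) the `w`-component of `GL_N(c ⊗ 1)k` is the image of the `w₀`-component of `k` under a ring endomorphism of `ℝ` resp. a continuous one of
`ℂ` — so `O(N)`∕`U(N)` membership transfers (★ `mem_Kinf_iff` place by place): **`GL_N((c⊗1))` maps `K_∞.map ofInfinite` into itself** (`map_conjAdele_map_Kinf_le`), and ★ (K) becomes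
LETTER-FREE: **`map_conjAdele_mem_standardMaximalCompactGL' (hc) (hg : g ∈ K_max) : GL_N((c⊗1)) g ∈ K_max`** — the letter (K) of ★ `K2E1ChiSectionGaloisTwistU2.conj_apply_eq_apply_galTwist_of_selfDual`.
HONEST LABEL: HC_CM is proved only modulo the 7 printed citations (2 remaining named inputs: hLiu418 = `stmt-HodgeConjecture-24832`, h413 = `stmt-HodgeConjecture-24833`) until rung 0
closes; this file asserts no named fact, closes no socket; count-neutral; letter-free.
[cite: BorelJacquet1979, §1.1 and §4.1] [cite: Knapp2002, I.§1]

## References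
* [BorelJacquet1979] A. Borel, H. Jacquet, *Automorphic forms and automorphic representations*, Proc. Symp. Pure Math. 33.1 (1979), §1.1, §4.1.
* [Knapp2002] A. W. Knapp, *Lie Groups Beyond an Introduction* (2002), I.§1.
-/

set_option autoImplicit false
set_option linter.dupNamespace false  -- the mandated namespace repeats the summit's segment (`HodgeConjecture.HodgeConjecture`)

noncomputable section

open NumberField NumberField.mixedEmbedding NumberField.InfinitePlace NumberField.InfinitePlace.Completion IsDedekindDomain
open scoped MatrixGroups ComplexConjugate
open Literature.NumberTheory.Automorphic Literature.NumberTheory.Automorphic.UnitaryGroup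
open Summit.HodgeConjecture.HodgeConjecture.Cruxes.H413.K2E1QuasiSplitGaloisTwistMaximalCompactU (map_conjAdele_mem_standardMaximalCompactGL)

namespace Summit.HodgeConjecture.HodgeConjecture.Cruxes.H413.K2E1QuasiSplitGaloisTwistArchCompactU

/-! ## §1 Rigidity: `star`-compatible ring homomorphisms preserve unitary matrices; `ℝ` and continuous `ℂ` endomorphisms are `star`-compatible -/

/-- **A `star`-compatible ring homomorphism maps `U(N, A)` into `U(N, B)`** (`(A.map ρ)ᴴ (A.map ρ) = (Aᴴ A).map ρ = 1`). [cite: Knapp2002, I.§1] -/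
theorem map_mem_unitarySubgroupGL {A B : Type*} [NormedCommRing A] [StarRing A] [NormedCommRing B] [StarRing B] {N : Type*} [Fintype N] [DecidableEq N]
    (ρ : A →+* B) (hρ : ∀ a, ρ (star a) = star (ρ a)) {g : GL N A} (hg : g ∈ unitarySubgroupGL A N) :
    Matrix.GeneralLinearGroup.map ρ g ∈ unitarySubgroupGL B N := by
  rw [mem_unitarySubgroupGL_iff] at hg ⊢
  change star ((g : Matrix N N A).map ρ) * (g : Matrix N N A).map ρ = 1
  rw [Matrix.star_eq_conjTranspose, ← Matrix.conjTranspose_map ρ hρ, ← Matrix.map_mul, ← Matrix.star_eq_conjTranspose, hg,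
    Matrix.map_one ρ (map_zero ρ) (map_one ρ)]

/-- Every ring endomorphism of `ℝ` is `star`-compatible (the star is trivial). [folklore] -/
theorem real_ringHom_star (ρ : ℝ →+* ℝ) (x : ℝ) : ρ (star x) = star (ρ x) := by
  rw [star_trivial, star_trivial]

/-- Every CONTINUOUS ring endomorphism of `ℂ` is `star`-compatible (it is `id` or `conj`). [folklore] -/
theorem complex_ringHom_star (ρ : ℂ →+* ℂ) (hρ : Continuous ρ) (z : ℂ) : ρ (star z) = star (ρ z) := by
  rcases Complex.ringHom_eq_id_or_conj_of_continuous hρ with h | h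
  · rw [h]; rfl
  · rw [h]; rfl

/-! ## §2 `GL_N((c ⊗ 1))` preserves `K_∞` -/

variable {F E : Type} [Field F] [Field E] [NumberField E] [Algebra F E] {c : E ≃ₐ[F] E} {n : ℕ}

omit [NumberField E] in
/-- Entries of `infiniteEquivMixed g` (definitional). [folklore] -/
theorem coe_infiniteEquivMixed_apply (g : GL (Fin n) (InfiniteAdeleRing E)) (i j : Fin n) :
    ((GLn.infiniteEquivMixed n E g : GL (Fin n) (mixedSpace E)) : Matrix (Fin n) (Fin n) (mixedSpace E)) i j =
      InfiniteAdeleRing.ringEquiv_mixedSpace E ((g : Matrix (Fin n) (Fin n) (InfiniteAdeleRing E)) i j) := rfl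

omit [NumberField E] in
/-- Entries of `infiniteEquivMixed.symm k` (definitional). [folklore] -/
theorem coe_infiniteEquivMixed_symm_apply (k : GL (Fin n) (mixedSpace E)) (i j : Fin n) :
    (((GLn.infiniteEquivMixed n E).symm k : GL (Fin n) (InfiniteAdeleRing E)) : Matrix (Fin n) (Fin n) (InfiniteAdeleRing E)) i j =
      (InfiniteAdeleRing.ringEquiv_mixedSpace E).symm ((k : Matrix (Fin n) (Fin n) (mixedSpace E)) i j) := rfl

/-- **`GL_N((c⊗1)) (k, 1) = (c·k, 1)`**: the Galois twist of an archimedean element is archimedean, with `c` acting on `GL_N(E_∞)` entrywise. [cite: BorelJacquet1979, §4.1] -/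
theorem map_conjAdele_ofInfinite (c : E ≃ₐ[F] E) (k : GL (Fin n) (mixedSpace E)) :
    Matrix.GeneralLinearGroup.map (conjAdele F E c) (GLn.ofInfinite n E k) =
      GLn.ofInfinite n E (GLn.infiniteEquivMixed n E (Matrix.GeneralLinearGroup.map (galInfiniteAdeleMap c) ((GLn.infiniteEquivMixed n E).symm k))) := by
  refine Matrix.GeneralLinearGroup.ext fun i j => ?_
  change c • ((GLn.ofInfinite n E k : Matrix (Fin n) (Fin n) (AdeleRing (𝓞 E) E)) i j) = _
  rw [GLn.coe_ofInfinite_apply, GLn.coe_ofInfinite_apply, coe_infiniteEquivMixed_apply, RingEquiv.symm_apply_apply]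
  refine Prod.ext ?_ ?_
  · rw [AdeleRing.smul_fst]; rfl
  · rw [AdeleRing.smul_snd, Matrix.one_apply]
    split_ifs
    · exact smul_one c
    · exact smul_zero c

/-- **The twisted archimedean element stays in `K_∞`**: at a complex (resp. real) place `w` its component is the image of the component of `k` at `w₀ = c⁻¹w` under a continuous ring
endomorphism of `ℂ` (resp. a ring endomorphism of `ℝ`), which preserves `U(N)` (resp. `O(N)`) by §1. [cite: BorelJacquet1979, §1.1] [cite: Knapp2002, I.§1] -/
theorem galTwist_mixed_mem_Kinf (c : E ≃ₐ[F] E) {k : GL (Fin n) (mixedSpace E)} (hk : k ∈ Kinf n E) :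
    GLn.infiniteEquivMixed n E (Matrix.GeneralLinearGroup.map (galInfiniteAdeleMap c) ((GLn.infiniteEquivMixed n E).symm k)) ∈ Kinf n E := by
  rw [mem_Kinf_iff] at hk ⊢
  refine ⟨fun w => ?_, fun w => ?_⟩
  · -- real place `w`, `w₀ = c⁻¹ w` real
    have hw₀ : (c⁻¹ • w.1).IsReal := (isReal_smul_iff).2 w.2
    set w₀ : {w : InfinitePlace E // w.IsReal} := ⟨c⁻¹ • w.1, hw₀⟩ with hw₀_def
    set ρ : ℝ →+* ℝ := (extensionEmbeddingOfIsReal w.2).comp ((galInfiniteCompletionMap c (smul_inv_smul c w.1)).comp (ringEquivRealOfIsReal hw₀).symm.toRingHom) with hρ_def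
    have key : Matrix.GeneralLinearGroup.map (mixedSpaceEvalReal E w)
        (GLn.infiniteEquivMixed n E (Matrix.GeneralLinearGroup.map (galInfiniteAdeleMap c) ((GLn.infiniteEquivMixed n E).symm k))) =
        Matrix.GeneralLinearGroup.map ρ (Matrix.GeneralLinearGroup.map (mixedSpaceEvalReal E w₀) k) := by
      refine Matrix.GeneralLinearGroup.ext fun i j => ?_
      set x : InfiniteAdeleRing E := (InfiniteAdeleRing.ringEquiv_mixedSpace E).symm ((k : Matrix (Fin n) (Fin n) (mixedSpace E)) i j) with hx_def
      have hx : (k : Matrix (Fin n) (Fin n) (mixedSpace E)) i j = InfiniteAdeleRing.ringEquiv_mixedSpace E x := by rw [hx_def, RingEquiv.apply_symm_apply]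
      change mixedSpaceEvalReal E w (InfiniteAdeleRing.ringEquiv_mixedSpace E (galInfiniteAdeleMap c
          ((((GLn.infiniteEquivMixed n E).symm k : GL (Fin n) (InfiniteAdeleRing E)) : Matrix (Fin n) (Fin n) (InfiniteAdeleRing E)) i j))) =
        ρ (mixedSpaceEvalReal E w₀ ((k : Matrix (Fin n) (Fin n) (mixedSpace E)) i j))
      rw [coe_infiniteEquivMixed_symm_apply, ← hx_def, hx, hρ_def]
      change extensionEmbeddingOfIsReal w.2 (galInfiniteCompletionMap c (smul_inv_smul c w.1) (x (c⁻¹ • w.1))) =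
        extensionEmbeddingOfIsReal w.2 (galInfiniteCompletionMap c (smul_inv_smul c w.1) ((ringEquivRealOfIsReal hw₀).symm (extensionEmbeddingOfIsReal hw₀ (x (c⁻¹ • w.1)))))
      rw [← ringEquivRealOfIsReal_apply hw₀, RingEquiv.symm_apply_apply]
    rw [key]
    exact map_mem_unitarySubgroupGL ρ (real_ringHom_star ρ) (hk.1 w₀)
  · -- complex place `w`, `w₀ = c⁻¹ w` complex
    have hw₀ : (c⁻¹ • w.1).IsComplex := (isComplex_smul_iff).2 w.2
    set w₀ : {w : InfinitePlace E // w.IsComplex} := ⟨c⁻¹ • w.1, hw₀⟩ with hw₀_def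
    set ρ : ℂ →+* ℂ := (extensionEmbedding w.1).comp ((galInfiniteCompletionMap c (smul_inv_smul c w.1)).comp (ringEquivComplexOfIsComplex hw₀).symm.toRingHom) with hρ_def
    have hρc : Continuous ρ := by
      have h1 : Continuous (ringEquivComplexOfIsComplex hw₀).symm := (isometryEquivComplexOfIsComplex hw₀).symm.continuous
      exact (isometry_extensionEmbedding w.1).continuous.comp ((continuous_galInfiniteCompletionMap F c (smul_inv_smul c w.1)).comp h1)
    have key : Matrix.GeneralLinearGroup.map (mixedSpaceEvalComplex E w)
        (GLn.infiniteEquivMixed n E (Matrix.GeneralLinearGroup.map (galInfiniteAdeleMap c) ((GLn.infiniteEquivMixed n E).symm k))) =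
        Matrix.GeneralLinearGroup.map ρ (Matrix.GeneralLinearGroup.map (mixedSpaceEvalComplex E w₀) k) := by
      refine Matrix.GeneralLinearGroup.ext fun i j => ?_
      set x : InfiniteAdeleRing E := (InfiniteAdeleRing.ringEquiv_mixedSpace E).symm ((k : Matrix (Fin n) (Fin n) (mixedSpace E)) i j) with hx_def
      have hx : (k : Matrix (Fin n) (Fin n) (mixedSpace E)) i j = InfiniteAdeleRing.ringEquiv_mixedSpace E x := by rw [hx_def, RingEquiv.apply_symm_apply]
      change mixedSpaceEvalComplex E w (InfiniteAdeleRing.ringEquiv_mixedSpace E (galInfiniteAdeleMap c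
          ((((GLn.infiniteEquivMixed n E).symm k : GL (Fin n) (InfiniteAdeleRing E)) : Matrix (Fin n) (Fin n) (InfiniteAdeleRing E)) i j))) =
        ρ (mixedSpaceEvalComplex E w₀ ((k : Matrix (Fin n) (Fin n) (mixedSpace E)) i j))
      rw [coe_infiniteEquivMixed_symm_apply, ← hx_def, hx, hρ_def]
      change extensionEmbedding w.1 (galInfiniteCompletionMap c (smul_inv_smul c w.1) (x (c⁻¹ • w.1))) =
        extensionEmbedding w.1 (galInfiniteCompletionMap c (smul_inv_smul c w.1) ((ringEquivComplexOfIsComplex hw₀).symm (extensionEmbedding (c⁻¹ • w.1) (x (c⁻¹ • w.1)))))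
      rw [← ringEquivComplexOfIsComplex_apply hw₀, RingEquiv.symm_apply_apply]
    rw [key]
    exact map_mem_unitarySubgroupGL ρ (complex_ringHom_star ρ hρc) (hk.2 w₀)

/-- **(K∞) `GL_N((c⊗1))` MAPS `K_∞ = (Kinf).map ofInfinite` INTO ITSELF** — the letter `hKinf` of ★ `map_conjAdele_mem_standardMaximalCompactGL`. [cite: BorelJacquet1979, §1.1 and §4.1] -/
theorem map_conjAdele_map_Kinf_le (c : E ≃ₐ[F] E) :
    ((Kinf n E).map (GLn.ofInfinite n E)).map (Matrix.GeneralLinearGroup.map (conjAdele F E c)) ≤ (Kinf n E).map (GLn.ofInfinite n E) := by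
  rintro _ ⟨_, ⟨k, hk, rfl⟩, rfl⟩
  exact ⟨_, galTwist_mixed_mem_Kinf c hk, (map_conjAdele_ofInfinite c k).symm⟩

/-- **(K) LETTER-FREE: `GL_N((c⊗1)) g ∈ K_max` for `g ∈ K_max = K_∞·GL_N(𝒪̂_E)`** (★ `map_conjAdele_mem_standardMaximalCompactGL` with `hKinf` discharged by (K∞)). [cite: BorelJacquet1979, §4.1] -/
theorem map_conjAdele_mem_standardMaximalCompactGL' (hc : c * c = 1) {g : GL (Fin n) (AdeleRing (𝓞 E) E)} (hg : g ∈ standardMaximalCompactGL n E) :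
    Matrix.GeneralLinearGroup.map (conjAdele F E c) g ∈ standardMaximalCompactGL n E :=
  map_conjAdele_mem_standardMaximalCompactGL hc (map_conjAdele_map_Kinf_le c) hg

/-- Iff form (`c² = 1`). [cite: BorelJacquet1979, §4.1] -/
theorem map_conjAdele_mem_standardMaximalCompactGL_iff (hc : c * c = 1) (g : GL (Fin n) (AdeleRing (𝓞 E) E)) :
    Matrix.GeneralLinearGroup.map (conjAdele F E c) g ∈ standardMaximalCompactGL n E ↔ g ∈ standardMaximalCompactGL n E := by
  refine ⟨fun h => ?_, map_conjAdele_mem_standardMaximalCompactGL' hc⟩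
  have h2 := map_conjAdele_mem_standardMaximalCompactGL' hc h
  have hid : Matrix.GeneralLinearGroup.map (conjAdele F E c) (Matrix.GeneralLinearGroup.map (conjAdele F E c) g) = g :=
    Matrix.GeneralLinearGroup.ext fun i j => by
      change conjAdele F E c (conjAdele F E c ((g : Matrix (Fin n) (Fin n) (AdeleRing (𝓞 E) E)) i j)) = _
      rw [conjAdele_apply, conjAdele_apply, smul_smul, hc, one_smul]
  rwa [hid] at h2

end Summit.HodgeConjecture.HodgeConjecture.Cruxes.H413.K2E1QuasiSplitGaloisTwistArchCompactU

end
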